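import Mathlib.LinearAlgebra.Matrix.Charpoly.Coeff
import Mathlib.LinearAlgebra.Matrix.Kronecker
import Literature.Computability.AlgebraicComplexity.GLAnnihilator
import HarnessLib

/-!
# Landsberg–Manivel–Ressayre 2013, §3.5: stabilizer dimensions of `det_n` and `P_Λ` (lower bounds)

LMR 2013 prove that `\overline{GL(W)·P_Λ}` has codimension one in `\overline{GL(W)·det_n}` by a Lie
algebra count: "we compute the stabilizer of `P_Λ` inside `GL(M_n(ℂ))` … the contribution of the
remaining terms is isomorphic with `𝔤𝔩_n ⊕ 𝔤𝔩_n`. In particular it has dimension `2n²`, which is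
one more than the dimension of the stabilizer of `[det_n]`" (arXiv `p0008.txt:L75`–`p0009.txt:L3`;
journal p. 481). In the typed convention of `GLAnnihilator.lean` (`glTangentMap`, `glAnn`) this file
proves the EXPLICIT-FAMILY halves of these counts:

* `glTangentMap_detPoly_kronecker`: the matrix `Aᵀ ⊗ 1 + 1 ⊗ B ∈ 𝔤𝔩(M_n)`, whose vector field is
  `M ↦ AM + MB`, acts on `det_n` by `(tr A + tr B)·det_n` — proved through dual numbers,
  `det((1 + εA)M(1 + εB)) = (1 + ε(tr A + tr B)) det M`;
* `exists_eq_smul_one_of_kronecker_eq_zero`: the parametrisation `(A, B) ↦ (M ↦ AM + MB)` has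
  kernel the line `ℂ·(1, −1)`;
* `two_mul_card_sq_le_finrank_glAnn_detPoly_add_two`, `finrank_glAnn_detPoly_ge`:
  `2n² − 2 ≤ dim 𝔤𝔩(W)_{det_n}`, and by rank–nullity (`finrank_glTangent_add_finrank_glAnn`)
  `dim 𝔤𝔩(W)·det_n ≤ n⁴ − 2n² + 2` (`finrank_glTangent_detPoly_add_le`).

* `glTangentMap_pLambda_kronecker`, `glTangentMap_pLambda_scalarFamily`,
  `glTangentMap_pLambda_homFamily`: three explicit families inside `𝔤𝔩(W)_{P_Λ}` —
  `M ↦ ZM + MZᵀ` acts on `P_Λ` by `2 tr Z` (through `P_Λ(gMgᵀ) = det(g)² P_Λ(M)`,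
  `trace_adjugate_conj_mul_conj`), the scalar element `(2−n)·1 − n·swap` kills `P_Λ` (bidegree
  `(n−1,1)` in `(A,S)`), and `M ↦ Z(M−Mᵀ) − (M−Mᵀ)Zᵀ ∈ Hom(Λ², S²)` kills `P_Λ`
  (`tr(adj(A)(ZA − AZᵀ)) = det A (tr Z − tr Z) = 0`);
* `pLambdaFamily_kernel`: the joint parametrisation has kernel the line `ℂ·(0,0,1)` (`n ≥ 3`);
* `finrank_glAnn_pLambda_ge`: `2n² − 1 ≤ dim 𝔤𝔩(W)_{P_Λ}` and `finrank_glTangent_pLambda_add_le`.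

Numerically (exact rank mod p at random points, `n = 3, 5`): `dim 𝔤𝔩(W)_{det_n} = 16, 48 = 2n²−2`
and `dim 𝔤𝔩(W)_{P_Λ} = 17, 49 = 2n²−1`, as printed. The reverse inequalities (Frobenius: these are
all of `𝔤𝔩(W)_{det_n}`; and `dim 𝔤𝔩(W)_{P_Λ} ≤ 2n²−1`, the exclusion of the irreducible
`GL_n`-modules `EA, ES, EAS, ESA` of `End(Λ² ⊕ S²)` in the source) are not proved in this file.
Theorem-only; no new definitions or facts. [cite: LandsbergManivelRessayre2013, §3.5 (p. 481)]
-/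

noncomputable section

open MvPolynomial Matrix

namespace Literature.Computability.AlgebraicComplexity

/-! ## Stabilizer dimensions (LMR 2013 §3.5): the explicit annihilator families -/

section StabilizerDimensions

open scoped Kronecker DualNumber
open TrivSqZeroExt

/-! ### Generic rank bookkeeping -/

/-- **Rank bookkeeping for an explicit family of annihilators.** If a linear family `Φ : V → W`
has kernel inside a line `ℂ·w` and maps the hyperplane `{τ = 0}` into `S`, then
`dim V ≤ dim S + 2` (rank–nullity twice). Used with `S = glAnn P` for `P = det_n, P_Λ`: this is the
dimension count "isomorphic with `𝔤𝔩_n ⊕ 𝔤𝔩_n` … it has dimension `2n²`", arXiv `p0009.txt:L1–2`.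
[cite: LandsbergManivelRessayre2013, §3.5 (p. 481)] -/
theorem finrank_le_finrank_add_two {V W : Type*} [AddCommGroup V] [Module ℂ V]
    [FiniteDimensional ℂ V] [AddCommGroup W] [Module ℂ W] [FiniteDimensional ℂ W]
    (Φ : V →ₗ[ℂ] W) (τ : V →ₗ[ℂ] ℂ) (S : Submodule ℂ W) (w : V)
    (hker : ∀ x, Φ x = 0 → ∃ c : ℂ, x = c • w) (hS : ∀ x, τ x = 0 → Φ x ∈ S) :
    Module.finrank ℂ V ≤ Module.finrank ℂ S + 2 := by
  have h1 := LinearMap.finrank_range_add_finrank_ker τ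
  have h2 : Module.finrank ℂ (LinearMap.range τ) ≤ 1 := by
    simpa using (LinearMap.range τ).finrank_le
  have h3 := LinearMap.finrank_range_add_finrank_ker (Φ ∘ₗ (LinearMap.ker τ).subtype)
  have h4 : LinearMap.range (Φ ∘ₗ (LinearMap.ker τ).subtype) ≤ S := by
    rintro _ ⟨x, rfl⟩
    exact hS x (LinearMap.mem_ker.1 x.2)
  have h5 := Submodule.finrank_mono h4
  have h6a : (LinearMap.ker (Φ ∘ₗ (LinearMap.ker τ).subtype)).map (LinearMap.ker τ).subtype ≤
      Submodule.span ℂ {w} := by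
    rintro _ ⟨x, hx, rfl⟩
    obtain ⟨c, hc⟩ := hker ((LinearMap.ker τ).subtype x) (LinearMap.mem_ker.1 hx)
    exact Submodule.mem_span_singleton.2 ⟨c, hc.symm⟩
  have h6b := LinearEquiv.finrank_eq
    (Submodule.equivMapOfInjective (LinearMap.ker τ).subtype (LinearMap.ker τ).injective_subtype
      (LinearMap.ker (Φ ∘ₗ (LinearMap.ker τ).subtype)))
  have h6c : Module.finrank ℂ (Submodule.span ℂ ({w} : Set V)) ≤ 1 := by
    simpa using finrank_span_le_card (R := ℂ) ({w} : Set V)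
  have h6 := (Submodule.finrank_mono h6a).trans h6c
  omega

/-! ### The determinant: the family `M ↦ AM + MB`, `tr A + tr B = 0` -/

variable {ι : Type*} [Fintype ι] [DecidableEq ι]

/-- The linear vector field of the matrix `Aᵀ ⊗ 1 + 1 ⊗ B ∈ 𝔤𝔩(M_n)` (in the convention of
`glTangentMap`) is `M ↦ AM + MB` on the generic matrix `M = (x_{ij})`: the infinitesimal form of the
action `M ↦ gMh` whose stabilizer computation LMR cite as "[the stabilizer of `[det_n]`]"
(arXiv `p0009.txt:L2–3`). [cite: LandsbergManivelRessayre2013, §3.5 (p. 481)] -/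
theorem sum_kronecker_smul_X (A B : Matrix ι ι ℂ) (i j : ι) :
    ∑ a : ι × ι, (Aᵀ ⊗ₖ (1 : Matrix ι ι ℂ) + (1 : Matrix ι ι ℂ) ⊗ₖ B) a (i, j) • MvPolynomial.X a =
      (A.map (C : ℂ →+* MvPolynomial (ι × ι) ℂ) * mvPolynomialX ι ι ℂ +
        mvPolynomialX ι ι ℂ * B.map (C : ℂ →+* MvPolynomial (ι × ι) ℂ)) i j := by
  have h1 : ∑ a : ι × ι, (Aᵀ ⊗ₖ (1 : Matrix ι ι ℂ)) a (i, j) • (MvPolynomial.X a : MvPolynomial (ι × ι) ℂ)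
      = ∑ k, A i k • MvPolynomial.X (k, j) := by
    rw [Fintype.sum_prod_type]
    refine Finset.sum_congr rfl fun k _ => ?_
    rw [Fintype.sum_eq_single j]
    · simp [Matrix.kroneckerMap_apply]
    · intro l hl
      simp [Matrix.kroneckerMap_apply, Matrix.one_apply_ne hl]
  have h2 : ∑ a : ι × ι, ((1 : Matrix ι ι ℂ) ⊗ₖ B) a (i, j) • (MvPolynomial.X a : MvPolynomial (ι × ι) ℂ)
      = ∑ l, B l j • MvPolynomial.X (i, l) := by
    rw [Fintype.sum_prod_type, Fintype.sum_eq_single i]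
    · simp [Matrix.kroneckerMap_apply]
    · intro k hk
      exact Finset.sum_eq_zero fun l _ => by simp [Matrix.kroneckerMap_apply, Matrix.one_apply_ne hk]
  simp only [Matrix.add_apply, add_smul, Finset.sum_add_distrib, h1, h2, Matrix.mul_apply,
    Matrix.map_apply, mvPolynomialX_apply]
  congr 1
  · exact Finset.sum_congr rfl fun k _ => by rw [MvPolynomial.C_mul']
  · exact Finset.sum_congr rfl fun l _ => by rw [mul_comm, MvPolynomial.C_mul']

/-- In dual numbers: substituting `M ↦ M + ε(AM + MB)` into the generic matrix gives
`(1 + εA) M (1 + εB)` (`ε² = 0`) — the curve `g_ε M h_ε` through the `GL × GL` action on `M_n`.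
[cite: LandsbergManivelRessayre2013, §3.5 (p. 481)] -/
theorem mapMatrix_aeval_mvPolynomialX_kronecker (A B : Matrix ι ι ℂ) :
    (aeval (fun b : ι × ι => (inl (MvPolynomial.X b) +
        inr (∑ a, (Aᵀ ⊗ₖ (1 : Matrix ι ι ℂ) + (1 : Matrix ι ι ℂ) ⊗ₖ B) a b • MvPolynomial.X a) :
        DualNumber (MvPolynomial (ι × ι) ℂ)))).mapMatrix (mvPolynomialX ι ι ℂ) =
      (1 + (ε : DualNumber (MvPolynomial (ι × ι) ℂ)) •
          (inlHom (MvPolynomial (ι × ι) ℂ) (MvPolynomial (ι × ι) ℂ)).mapMatrix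
            (A.map (C : ℂ →+* MvPolynomial (ι × ι) ℂ))) *
        (inlHom (MvPolynomial (ι × ι) ℂ) (MvPolynomial (ι × ι) ℂ)).mapMatrix (mvPolynomialX ι ι ℂ) *
        (1 + (ε : DualNumber (MvPolynomial (ι × ι) ℂ)) •
          (inlHom (MvPolynomial (ι × ι) ℂ) (MvPolynomial (ι × ι) ℂ)).mapMatrix
            (B.map (C : ℂ →+* MvPolynomial (ι × ι) ℂ))) := by
  have key : ∀ M N Q : Matrix ι ι (DualNumber (MvPolynomial (ι × ι) ℂ)),
      (1 + (ε : DualNumber (MvPolynomial (ι × ι) ℂ)) • M) * N *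
          (1 + (ε : DualNumber (MvPolynomial (ι × ι) ℂ)) • Q) =
        N + (ε : DualNumber (MvPolynomial (ι × ι) ℂ)) • (M * N + N * Q) := by
    intro M N Q
    simp only [add_mul, one_mul, mul_add, mul_one, Matrix.smul_mul, Matrix.mul_smul, smul_smul,
      DualNumber.eps_mul_eps, zero_smul, add_zero, smul_add]
    abel
  rw [key, ← map_mul, ← map_mul, ← map_add]
  refine Matrix.ext fun i j => ?_
  rw [AlgHom.mapMatrix_apply, Matrix.map_apply, mvPolynomialX_apply, aeval_X, sum_kronecker_smul_X]
  conv_rhs => rw [Matrix.add_apply, Matrix.smul_apply, RingHom.mapMatrix_apply, Matrix.map_apply,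
    RingHom.mapMatrix_apply, Matrix.map_apply, mvPolynomialX_apply, smul_eq_mul]
  change _ = inl _ + DualNumber.eps * inl _
  rw [mul_comm, inl_mul_eq_smul, ← DualNumber.inr_eq_smul_eps]

/-- **`(AM + MB) · ∇det = (tr A + tr B) det`**: the `ε¹`-part of
`det((1 + εA) M (1 + εB)) = det(1 + εA) det M det(1 + εB) = (1 + ε(tr A + tr B)) det M`. Hence
`M ↦ AM + MB` with `tr A + tr B = 0` lies in the annihilator `𝔤𝔩(W)_{det_n}` ("the stabilizer of
`[det_n]`", arXiv `p0009.txt:L2–3`; classical, Frobenius 1897).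
[cite: LandsbergManivelRessayre2013, §3.5 (p. 481)] -/
theorem glTangentMap_detPoly_kronecker (A B : Matrix ι ι ℂ) :
    glTangentMap (detPoly ι ℂ) (Aᵀ ⊗ₖ (1 : Matrix ι ι ℂ) + (1 : Matrix ι ι ℂ) ⊗ₖ B) =
      (A.trace + B.trace) • detPoly ι ℂ := by
  rw [glTangentMap_eq_snd_aeval,
    show detPoly ι ℂ = (mvPolynomialX ι ι ℂ).det from rfl, AlgHom.map_det,
    mapMatrix_aeval_mvPolynomialX_kronecker, Matrix.det_mul, Matrix.det_mul,
    Matrix.det_one_add_smul (ε : DualNumber (MvPolynomial (ι × ι) ℂ))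
      ((inlHom (MvPolynomial (ι × ι) ℂ) (MvPolynomial (ι × ι) ℂ)).mapMatrix
        (A.map (C : ℂ →+* MvPolynomial (ι × ι) ℂ))),
    Matrix.det_one_add_smul (ε : DualNumber (MvPolynomial (ι × ι) ℂ))
      ((inlHom (MvPolynomial (ι × ι) ℂ) (MvPolynomial (ι × ι) ℂ)).mapMatrix
        (B.map (C : ℂ →+* MvPolynomial (ι × ι) ℂ))),
    ← RingHom.map_det, sq (ε : DualNumber (MvPolynomial (ι × ι) ℂ)), DualNumber.eps_mul_eps,
    mul_zero, add_zero, mul_zero, add_zero, RingHom.mapMatrix_apply, RingHom.mapMatrix_apply,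
    ← AddMonoidHom.map_trace (inlHom (MvPolynomial (ι × ι) ℂ) (MvPolynomial (ι × ι) ℂ)),
    ← AddMonoidHom.map_trace (inlHom (MvPolynomial (ι × ι) ℂ) (MvPolynomial (ι × ι) ℂ)),
    ← AddMonoidHom.map_trace (C : ℂ →+* MvPolynomial (ι × ι) ℂ),
    ← AddMonoidHom.map_trace (C : ℂ →+* MvPolynomial (ι × ι) ℂ)]
  change snd ((1 + inl (C A.trace) * ε) * inl (mvPolynomialX ι ι ℂ).det *
    (1 + inl (C B.trace) * ε)) = _
  simp only [DualNumber.snd_mul, fst_mul, fst_add, snd_add, fst_one, snd_one, fst_inl, snd_inl,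
    DualNumber.fst_eps, DualNumber.snd_eps, mul_zero, mul_one, zero_add, add_zero,
    smul_eq_C_mul, map_add]
  ring

/-- The family `{M ↦ AM + MB : tr A + tr B = 0}` lies in `𝔤𝔩(W)_{det_n}`.
[cite: LandsbergManivelRessayre2013, §3.5 (p. 481)] -/
theorem kronecker_mem_glAnn_detPoly {A B : Matrix ι ι ℂ} (h : A.trace + B.trace = 0) :
    Aᵀ ⊗ₖ (1 : Matrix ι ι ℂ) + (1 : Matrix ι ι ℂ) ⊗ₖ B ∈ glAnn (detPoly ι ℂ) := by
  rw [mem_glAnn_iff_glTangentMap_eq_zero, glTangentMap_detPoly_kronecker, h, zero_smul]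

omit [Fintype ι] in
/-- The parametrisation `(A, B) ↦ (M ↦ AM + MB)` has kernel the line `ℂ·(1, −1)`
(independence "modulo `(λ1, −λ1)`" behind the count `dim = 2n² − 1` for `[det_n]`,
arXiv `p0009.txt:L2–3`). [cite: LandsbergManivelRessayre2013, §3.5 (p. 481)] -/
theorem exists_eq_smul_one_of_kronecker_eq_zero (A B : Matrix ι ι ℂ)
    (h : Aᵀ ⊗ₖ (1 : Matrix ι ι ℂ) + (1 : Matrix ι ι ℂ) ⊗ₖ B = 0) :
    ∃ c : ℂ, A = c • (1 : Matrix ι ι ℂ) ∧ B = -(c • (1 : Matrix ι ι ℂ)) := by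
  have e : ∀ k l i j : ι, A i k * (1 : Matrix ι ι ℂ) l j + (1 : Matrix ι ι ℂ) k i * B l j = 0 := by
    intro k l i j
    have := congr_fun (congr_fun h (k, l)) (i, j)
    simpa [Matrix.kroneckerMap_apply] using this
  have hA : ∀ i k, i ≠ k → A i k = 0 := fun i k hik => by
    simpa [Matrix.one_apply_ne (Ne.symm hik)] using e k i i i
  have hB : ∀ l j, l ≠ j → B l j = 0 := fun l j hlj => by
    simpa [Matrix.one_apply_ne hlj] using e j l j j
  have hd : ∀ i j, A i i + B j j = 0 := fun i j => by simpa using e i j i j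
  rcases isEmpty_or_nonempty ι with hι | ⟨⟨i₀⟩⟩
  · exact ⟨0, by ext i; exact (IsEmpty.false i).elim, by ext i; exact (IsEmpty.false i).elim⟩
  refine ⟨A i₀ i₀, ?_, ?_⟩
  · ext i k
    by_cases hik : i = k
    · subst hik
      have h1 := hd i i₀
      have h2 := hd i₀ i₀
      simp only [Matrix.smul_apply, Matrix.one_apply_eq, smul_eq_mul, mul_one]
      linear_combination h1 - h2
    · rw [hA i k hik, Matrix.smul_apply, Matrix.one_apply_ne hik, smul_zero]
  · ext l j
    by_cases hlj : l = j
    · subst hlj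
      have h1 := hd i₀ l
      simp only [Matrix.neg_apply, Matrix.smul_apply, Matrix.one_apply_eq, smul_eq_mul, mul_one]
      linear_combination h1
    · rw [hB l j hlj, Matrix.neg_apply, Matrix.smul_apply, Matrix.one_apply_ne hlj, smul_zero, neg_zero]

/-- **Lower bound on the annihilator of the determinant**: `2n² − 2 ≤ dim 𝔤𝔩(W)_{det_n}`
(`n = |ι|`), witnessed by the family `M ↦ AM + MB`, `tr A + tr B = 0`, which is
`(2n² − 1) − 1`-dimensional. This is the easy half of "the dimension of the stabilizer of `[det_n]`
[is `2n² − 1`]" (arXiv `p0009.txt:L2–3`; the reverse inequality is Frobenius' theorem and is not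
proved here). [cite: LandsbergManivelRessayre2013, §3.5 (p. 481)] -/
theorem two_mul_card_sq_le_finrank_glAnn_detPoly_add_two :
    2 * Fintype.card ι ^ 2 ≤ Module.finrank ℂ (glAnn (detPoly ι ℂ)) + 2 := by
  let Φ : (Matrix ι ι ℂ × Matrix ι ι ℂ) →ₗ[ℂ] Matrix (ι × ι) (ι × ι) ℂ :=
    { toFun := fun AB => AB.1ᵀ ⊗ₖ (1 : Matrix ι ι ℂ) + (1 : Matrix ι ι ℂ) ⊗ₖ AB.2
      map_add' := fun x y => by
        simp only [Prod.fst_add, Prod.snd_add, Matrix.transpose_add, Matrix.add_kronecker,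
          Matrix.kronecker_add]
        abel
      map_smul' := fun c x => by
        simp only [Prod.smul_fst, Prod.smul_snd, Matrix.transpose_smul, Matrix.smul_kronecker,
          Matrix.kronecker_smul, RingHom.id_apply, smul_add] }
  let τ : (Matrix ι ι ℂ × Matrix ι ι ℂ) →ₗ[ℂ] ℂ :=
    Matrix.traceLinearMap ι ℂ ℂ ∘ₗ LinearMap.fst ℂ _ _ + Matrix.traceLinearMap ι ℂ ℂ ∘ₗ LinearMap.snd ℂ _ _
  have h := finrank_le_finrank_add_two Φ τ (glAnn (detPoly ι ℂ))
    ((1 : Matrix ι ι ℂ), -(1 : Matrix ι ι ℂ)) ?_ ?_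
  · rw [Module.finrank_prod, Module.finrank_matrix, Module.finrank_self, mul_one, ← sq] at h
    omega
  · rintro ⟨A, B⟩ hAB
    obtain ⟨c, hA, hB⟩ := exists_eq_smul_one_of_kronecker_eq_zero A B hAB
    exact ⟨c, by ext1 <;> simp [hA, hB]⟩
  · rintro ⟨A, B⟩ hAB
    exact kronecker_mem_glAnn_detPoly hAB

/-- `2n² − 2 ≤ dim 𝔤𝔩(W)_{det_n}` for `W = M_n(ℂ)`, `σ = Fin n × Fin n`.
[cite: LandsbergManivelRessayre2013, §3.5 (p. 481)] -/
theorem finrank_glAnn_detPoly_ge (n : ℕ) :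
    2 * n ^ 2 - 2 ≤ Module.finrank ℂ (glAnn (detPoly (Fin n) ℂ)) := by
  have h := two_mul_card_sq_le_finrank_glAnn_detPoly_add_two (ι := Fin n)
  rw [Fintype.card_fin] at h
  omega

/-- The rank–nullity corollary: `dim 𝔤𝔩(W)·det_n ≤ n⁴ − 2n² + 2`
("`T̂_{[det_n]} PGL(M_n)·[det_n]`", arXiv `p0008.txt:L41`).
[cite: LandsbergManivelRessayre2013, §3.4–§3.5 (pp. 479–481)] -/
theorem finrank_glTangent_detPoly_add_le (n : ℕ) :
    Module.finrank ℂ (glTangent (detPoly (Fin n) ℂ)) + (2 * n ^ 2 - 2) ≤ n ^ 4 := by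
  have h1 := finrank_glTangent_add_finrank_glAnn (detPoly (Fin n) ℂ)
  have h2 := finrank_glAnn_detPoly_ge n
  rw [Fintype.card_prod, Fintype.card_fin] at h1
  have h3 : (n * n) ^ 2 = n ^ 4 := by ring
  omega


/-! ### Two more pieces of matrix calculus in dual numbers -/

/-- The generic matrix under the first-order substitution of a general `L ∈ 𝔤𝔩(W)`:
`M ↦ M + ε V_L(M)`, `V_L(M)_{ij} = ∑_a L_{a,(i,j)} x_a`.
[cite: LandsbergManivelRessayre2013, §3.5 (p. 481)] -/
theorem mapMatrix_aeval_mvPolynomialX (L : Matrix (ι × ι) (ι × ι) ℂ) :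
    (aeval (fun b : ι × ι => (inl (MvPolynomial.X b) + inr (∑ a, L a b • MvPolynomial.X a) :
        DualNumber (MvPolynomial (ι × ι) ℂ)))).mapMatrix (mvPolynomialX ι ι ℂ) =
      (inlHom (MvPolynomial (ι × ι) ℂ) (MvPolynomial (ι × ι) ℂ)).mapMatrix (mvPolynomialX ι ι ℂ) +
        (ε : DualNumber (MvPolynomial (ι × ι) ℂ)) •
          (inlHom (MvPolynomial (ι × ι) ℂ) (MvPolynomial (ι × ι) ℂ)).mapMatrix
            (Matrix.of fun i j : ι => ∑ a, L a (i, j) • MvPolynomial.X a) := by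
  refine Matrix.ext fun i j => ?_
  rw [AlgHom.mapMatrix_apply, Matrix.map_apply, mvPolynomialX_apply, aeval_X]
  conv_rhs => rw [Matrix.add_apply, Matrix.smul_apply, RingHom.mapMatrix_apply, Matrix.map_apply,
    RingHom.mapMatrix_apply, Matrix.map_apply, mvPolynomialX_apply, Matrix.of_apply, smul_eq_mul]
  change _ = inl _ + DualNumber.eps * inl _
  rw [mul_comm, inl_mul_eq_smul, ← DualNumber.inr_eq_smul_eps]

omit [Fintype ι] in
/-- `det(1 + εM) = 1 + ε tr M` in dual numbers (`Matrix.det_one_add_smul` with `ε² = 0`).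
[cite: LandsbergManivelRessayre2013, §3.5 (p. 481)] -/
theorem det_one_add_eps_smul [Fintype ι] {R : Type*} [CommRing R]
    (M : Matrix ι ι (DualNumber R)) :
    (1 + (ε : DualNumber R) • M).det = 1 + M.trace * ε := by
  rw [Matrix.det_one_add_smul, sq (ε : DualNumber R), DualNumber.eps_mul_eps, mul_zero, add_zero]

omit [DecidableEq ι] in
/-- Conjugation `N ↦ g N gᵀ` commutes with taking the skew part.
[cite: LandsbergManivelRessayre2013, §3.5 (p. 481)] -/
theorem smul_conj_sub_transpose {R : Type*} [CommRing R] (c : R) (g N : Matrix ι ι R) :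
    c • (g * N * gᵀ - (g * N * gᵀ)ᵀ) = g * (c • (N - Nᵀ)) * gᵀ := by
  rw [Matrix.transpose_mul, Matrix.transpose_mul, Matrix.transpose_transpose, ← Matrix.mul_assoc,
    ← Matrix.sub_mul, ← Matrix.mul_sub, Matrix.mul_smul, Matrix.smul_mul]

omit [DecidableEq ι] in
/-- Conjugation `N ↦ g N gᵀ` commutes with taking the symmetric part.
[cite: LandsbergManivelRessayre2013, §3.5 (p. 481)] -/
theorem smul_conj_add_transpose {R : Type*} [CommRing R] (c : R) (g N : Matrix ι ι R) :
    c • (g * N * gᵀ + (g * N * gᵀ)ᵀ) = g * (c • (N + Nᵀ)) * gᵀ := by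
  rw [Matrix.transpose_mul, Matrix.transpose_mul, Matrix.transpose_transpose, ← Matrix.mul_assoc,
    ← Matrix.add_mul, ← Matrix.mul_add, Matrix.mul_smul, Matrix.smul_mul]

/-- **`tr(adj(gAgᵀ)·gSgᵀ) = det(g)² tr(adj(A) S)`** (`adj(XY) = adj(Y)adj(X)`, `adj(g)g = det g`):
the `GL_n`-equivariance "the action of `GL_n(ℂ)` on `M_n(ℂ)` by `M ↦ gMgᵗ` preserves `P_Λ` up to
scale" (arXiv `p0008.txt:L79`). [cite: LandsbergManivelRessayre2013, §3.5 (p. 481)] -/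
theorem trace_adjugate_conj_mul_conj {R : Type*} [CommRing R] (g A S : Matrix ι ι R) :
    ((g * A * gᵀ).adjugate * (g * S * gᵀ)).trace = g.det ^ 2 * (A.adjugate * S).trace := by
  rw [Matrix.adjugate_mul_distrib, Matrix.adjugate_mul_distrib]
  have e : gᵀ.adjugate * (A.adjugate * g.adjugate) * (g * S * gᵀ) =
      gᵀ.adjugate * (A.adjugate * ((g.adjugate * g) * (S * gᵀ))) := by
    simp only [Matrix.mul_assoc]
  rw [e, Matrix.trace_mul_comm, Matrix.adjugate_mul, Matrix.smul_mul, Matrix.one_mul,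
    Matrix.mul_smul, Matrix.smul_mul, Matrix.trace_smul]
  have e' : A.adjugate * (S * gᵀ) * gᵀ.adjugate = A.adjugate * S * (gᵀ * gᵀ.adjugate) := by
    simp only [Matrix.mul_assoc]
  rw [e', Matrix.mul_adjugate, Matrix.det_transpose, Matrix.mul_smul, Matrix.mul_one,
    Matrix.trace_smul, smul_smul, smul_eq_mul, sq]

/-! ### `P_Λ`: the families `M ↦ ZM + MZᵀ`, `(2−n)·id − n·transpose`, `M ↦ Z(M−Mᵀ) − (M−Mᵀ)Zᵀ` -/

section PLambda

variable (n : ℕ)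

/-- `P_Λ` under an algebra map `f`: `f(P_Λ) = (1/n) tr(adj(A_f) S_f)` with `A_f, S_f` the skew and
symmetric parts of `f` applied to the generic matrix ("`P_Λ(M) = det_n(A,…,A,S)`",
arXiv `p0008.txt:L49`, as typed in `pLambda`). [cite: LandsbergManivelRessayre2013, §3.5 (p. 480)] -/
theorem algHom_pLambda {S : Type*} [CommRing S] [Algebra ℂ S]
    (f : MvPolynomial (Fin n × Fin n) ℂ →ₐ[ℂ] S) :
    f (pLambda n) = algebraMap ℂ S (1 / (n : ℂ)) *
      ((algebraMap ℂ S (1 / 2) • (f.mapMatrix (mvPolynomialX (Fin n) (Fin n) ℂ) -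
          (f.mapMatrix (mvPolynomialX (Fin n) (Fin n) ℂ))ᵀ)).adjugate *
        (algebraMap ℂ S (1 / 2) • (f.mapMatrix (mvPolynomialX (Fin n) (Fin n) ℂ) +
          (f.mapMatrix (mvPolynomialX (Fin n) (Fin n) ℂ))ᵀ))).trace := by
  have hA : f.mapMatrix (skewPartMatrix n) = algebraMap ℂ S (1 / 2) •
      (f.mapMatrix (mvPolynomialX (Fin n) (Fin n) ℂ) -
        (f.mapMatrix (mvPolynomialX (Fin n) (Fin n) ℂ))ᵀ) :=
    Matrix.ext fun i j => by
      simp [skewPartMatrix, AlgHom.mapMatrix_apply, Matrix.map_apply, mvPolynomialX_apply, map_mul,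
        map_sub, MvPolynomial.algHom_C]
  have hS : f.mapMatrix (symPartMatrix n) = algebraMap ℂ S (1 / 2) •
      (f.mapMatrix (mvPolynomialX (Fin n) (Fin n) ℂ) +
        (f.mapMatrix (mvPolynomialX (Fin n) (Fin n) ℂ))ᵀ) :=
    Matrix.ext fun i j => by
      simp [symPartMatrix, AlgHom.mapMatrix_apply, Matrix.map_apply, mvPolynomialX_apply, map_mul,
        map_add, MvPolynomial.algHom_C]
  rw [pLambda, map_mul, MvPolynomial.algHom_C, AddMonoidHom.map_trace f, ← AlgHom.mapMatrix_apply,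
    map_mul, AlgHom.map_adjugate, hA, hS]

/-- `inl ∘ C = algebraMap ℂ R[ε]` on scalars. [cite: LandsbergManivelRessayre2013, §3.5 (p. 480)] -/
theorem inlHom_C (r : ℂ) : (inlHom (MvPolynomial (Fin n × Fin n) ℂ) (MvPolynomial (Fin n × Fin n) ℂ)) (C r) = algebraMap ℂ (DualNumber (MvPolynomial (Fin n × Fin n) ℂ)) r := by
  rw [algebraMap_eq_inl', MvPolynomial.algebraMap_eq]
  rfl

/-- The typed skew part `A = (M − Mᵀ)/2` read in `R[ε]`.
[cite: LandsbergManivelRessayre2013, §3.5 (p. 480)] -/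
theorem inlHom_mapMatrix_skewPartMatrix :
    (inlHom (MvPolynomial (Fin n × Fin n) ℂ) (MvPolynomial (Fin n × Fin n) ℂ)).mapMatrix (skewPartMatrix n) =
      algebraMap ℂ (DualNumber (MvPolynomial (Fin n × Fin n) ℂ)) (1 / 2) •
        ((inlHom (MvPolynomial (Fin n × Fin n) ℂ) (MvPolynomial (Fin n × Fin n) ℂ)).mapMatrix (mvPolynomialX (Fin n) (Fin n) ℂ) - ((inlHom (MvPolynomial (Fin n × Fin n) ℂ) (MvPolynomial (Fin n × Fin n) ℂ)).mapMatrix (mvPolynomialX (Fin n) (Fin n) ℂ))ᵀ) :=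
  Matrix.ext fun i j => by
    simp only [skewPartMatrix, RingHom.mapMatrix_apply, Matrix.map_apply, mvPolynomialX_apply,
      Matrix.of_apply, map_mul, map_sub, inlHom_C, Matrix.smul_apply, Matrix.sub_apply,
      Matrix.transpose_apply, smul_eq_mul]

/-- The typed symmetric part `S = (M + Mᵀ)/2` read in `R[ε]`.
[cite: LandsbergManivelRessayre2013, §3.5 (p. 480)] -/
theorem inlHom_mapMatrix_symPartMatrix :
    (inlHom (MvPolynomial (Fin n × Fin n) ℂ) (MvPolynomial (Fin n × Fin n) ℂ)).mapMatrix (symPartMatrix n) =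
      algebraMap ℂ (DualNumber (MvPolynomial (Fin n × Fin n) ℂ)) (1 / 2) •
        ((inlHom (MvPolynomial (Fin n × Fin n) ℂ) (MvPolynomial (Fin n × Fin n) ℂ)).mapMatrix (mvPolynomialX (Fin n) (Fin n) ℂ) + ((inlHom (MvPolynomial (Fin n × Fin n) ℂ) (MvPolynomial (Fin n × Fin n) ℂ)).mapMatrix (mvPolynomialX (Fin n) (Fin n) ℂ))ᵀ) :=
  Matrix.ext fun i j => by
    simp only [symPartMatrix, RingHom.mapMatrix_apply, Matrix.map_apply, mvPolynomialX_apply,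
      Matrix.of_apply, map_mul, map_add, inlHom_C, Matrix.smul_apply, Matrix.add_apply,
      Matrix.transpose_apply, smul_eq_mul]

/-- The same for the scalar extension `inl : R → R[ε]`: `inl(P_Λ) = (1/n) tr(adj(A)S)` computed
inside `R[ε]`. [cite: LandsbergManivelRessayre2013, §3.5 (p. 480)] -/
theorem inl_pLambda :
    (inl (pLambda n) : DualNumber (MvPolynomial (Fin n × Fin n) ℂ)) =
      algebraMap ℂ (DualNumber (MvPolynomial (Fin n × Fin n) ℂ)) (1 / (n : ℂ)) *
      ((algebraMap ℂ (DualNumber (MvPolynomial (Fin n × Fin n) ℂ)) (1 / 2) •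
          ((inlHom (MvPolynomial (Fin n × Fin n) ℂ) (MvPolynomial (Fin n × Fin n) ℂ)).mapMatrix
              (mvPolynomialX (Fin n) (Fin n) ℂ) -
            ((inlHom (MvPolynomial (Fin n × Fin n) ℂ) (MvPolynomial (Fin n × Fin n) ℂ)).mapMatrix
              (mvPolynomialX (Fin n) (Fin n) ℂ))ᵀ)).adjugate *
        (algebraMap ℂ (DualNumber (MvPolynomial (Fin n × Fin n) ℂ)) (1 / 2) •
          ((inlHom (MvPolynomial (Fin n × Fin n) ℂ) (MvPolynomial (Fin n × Fin n) ℂ)).mapMatrix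
              (mvPolynomialX (Fin n) (Fin n) ℂ) +
            ((inlHom (MvPolynomial (Fin n × Fin n) ℂ) (MvPolynomial (Fin n × Fin n) ℂ)).mapMatrix
              (mvPolynomialX (Fin n) (Fin n) ℂ))ᵀ))).trace := by
  change (inlHom (MvPolynomial (Fin n × Fin n) ℂ) (MvPolynomial (Fin n × Fin n) ℂ)) (pLambda n) = _
  rw [pLambda, map_mul, inlHom_C, AddMonoidHom.map_trace (inlHom (MvPolynomial (Fin n × Fin n) ℂ) (MvPolynomial (Fin n × Fin n) ℂ)),
    ← RingHom.mapMatrix_apply, map_mul, RingHom.map_adjugate, inlHom_mapMatrix_skewPartMatrix,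
    inlHom_mapMatrix_symPartMatrix]

/-- **`(ZM + MZᵀ)·∇P_Λ = 2 tr(Z) P_Λ`**: the Lie algebra of "the action of `GL_n(ℂ)` on `M_n(ℂ)`
by `M ↦ gMgᵗ` preserves `P_Λ` up to scale" (arXiv `p0008.txt:L79`), through
`P_Λ(gMgᵀ) = det(g)² P_Λ(M)` at `g = 1 + εZ`. [cite: LandsbergManivelRessayre2013, §3.5 (p. 481)] -/
theorem glTangentMap_pLambda_kronecker (Z : Matrix (Fin n) (Fin n) ℂ) :
    glTangentMap (pLambda n)
        (Zᵀ ⊗ₖ (1 : Matrix (Fin n) (Fin n) ℂ) + (1 : Matrix (Fin n) (Fin n) ℂ) ⊗ₖ Zᵀ) =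
      (2 * Z.trace) • pLambda n := by
  have hsnd : snd (((1 : DualNumber (MvPolynomial (Fin n × Fin n) ℂ)) + (inlHom (MvPolynomial (Fin n × Fin n) ℂ) (MvPolynomial (Fin n × Fin n) ℂ)) (C Z.trace) * ε) ^ 2 *
      (inl (pLambda n) : DualNumber (MvPolynomial (Fin n × Fin n) ℂ))) = (2 * Z.trace) • pLambda n := by
    rw [show (inlHom (MvPolynomial (Fin n × Fin n) ℂ) (MvPolynomial (Fin n × Fin n) ℂ)) (C Z.trace) = (inl (C Z.trace) : DualNumber (MvPolynomial (Fin n × Fin n) ℂ)) from rfl]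
    simp only [sq, DualNumber.snd_mul, fst_mul, fst_add, snd_add, fst_one, snd_one, fst_inl, snd_inl,
      DualNumber.fst_eps, DualNumber.snd_eps, mul_zero, mul_one, zero_add, add_zero,
      smul_eq_C_mul, map_mul, map_ofNat]
    ring
  rw [← hsnd, glTangentMap_eq_snd_aeval, algHom_pLambda, mapMatrix_aeval_mvPolynomialX_kronecker,
    inl_pLambda]
  apply congrArg
  set g := 1 + (ε : DualNumber (MvPolynomial (Fin n × Fin n) ℂ)) •
    (inlHom (MvPolynomial (Fin n × Fin n) ℂ) (MvPolynomial (Fin n × Fin n) ℂ)).mapMatrix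
      (Z.map (C : ℂ →+* MvPolynomial (Fin n × Fin n) ℂ)) with hg
  have hgT : 1 + (ε : DualNumber (MvPolynomial (Fin n × Fin n) ℂ)) •
      (inlHom (MvPolynomial (Fin n × Fin n) ℂ) (MvPolynomial (Fin n × Fin n) ℂ)).mapMatrix
        (Zᵀ.map (C : ℂ →+* MvPolynomial (Fin n × Fin n) ℂ)) = gᵀ := by
    rw [hg, Matrix.transpose_add, Matrix.transpose_one, Matrix.transpose_smul,
      RingHom.mapMatrix_apply, RingHom.mapMatrix_apply, Matrix.transpose_map, Matrix.transpose_map]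
  rw [hgT, smul_conj_sub_transpose, smul_conj_add_transpose, trace_adjugate_conj_mul_conj, hg,
    det_one_add_eps_smul, RingHom.mapMatrix_apply, ← AddMonoidHom.map_trace (inlHom (MvPolynomial (Fin n × Fin n) ℂ) (MvPolynomial (Fin n × Fin n) ℂ)),
    ← AddMonoidHom.map_trace (C : ℂ →+* MvPolynomial (Fin n × Fin n) ℂ)]
  ring

/-- The linear vector field of the second family `(2−n)·1 − n·swap ∈ 𝔤𝔩(M_n)`:
`M ↦ (2−n)M − nMᵀ`. [cite: LandsbergManivelRessayre2013, §3.5 (p. 481)] -/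
theorem of_sum_scalarFamily_smul_X :
    (Matrix.of fun i j : Fin n => ∑ a : Fin n × Fin n,
      (((2 : ℂ) - n) • (1 : Matrix (Fin n × Fin n) (Fin n × Fin n) ℂ) -
        (n : ℂ) • (1 : Matrix (Fin n × Fin n) (Fin n × Fin n) ℂ).submatrix id Prod.swap) a (i, j) •
          (MvPolynomial.X a : MvPolynomial (Fin n × Fin n) ℂ)) =
      ((2 : MvPolynomial (Fin n × Fin n) ℂ) - n) • mvPolynomialX (Fin n) (Fin n) ℂ -
        (n : MvPolynomial (Fin n × Fin n) ℂ) • (mvPolynomialX (Fin n) (Fin n) ℂ)ᵀ := by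
  refine Matrix.ext fun i j => ?_
  simp only [Matrix.of_apply, Matrix.sub_apply, Matrix.smul_apply, Matrix.submatrix_apply, id,
    Prod.swap_prod_mk, Matrix.one_apply, smul_eq_mul, mul_ite, mul_one, mul_zero, sub_smul,
    Finset.sum_sub_distrib, ite_smul, zero_smul, Finset.sum_ite_eq', Finset.mem_univ, if_true,
    Matrix.transpose_apply, mvPolynomialX_apply, MvPolynomial.smul_eq_C_mul, map_natCast,
    map_ofNat]
set_option maxHeartbeats 400000 in -- buildfix (bf3-g31): 160k/180k FAIL, 200k PASS at accept time; line-neutral budget line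
/-- **The second family kills `P_Λ`**: `((2−n)·1 − n·swap) · P_Λ = 0`. Substituting
`M ↦ M + ε((2−n)M − nMᵀ)` scales the skew part by `1 + 2ε` and the symmetric part by `1 + (2−2n)ε`;
`P_Λ = (1/n)tr(adj(A)S)` has bidegree `(n−1, 1)` in `(A, S)` and `2(n−1) + (2−2n) = 0` (the scalar
part `ℂ ⊕ ℂ ⊂ End(Λ²) ⊕ End(S²)` of the stabilizer, arXiv `p0008.txt:L83–85`).
[cite: LandsbergManivelRessayre2013, §3.5 (p. 481)] -/
theorem glTangentMap_pLambda_scalarFamily (hn : 1 ≤ n) :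
    glTangentMap (pLambda n) (((2 : ℂ) - n) • (1 : Matrix (Fin n × Fin n) (Fin n × Fin n) ℂ) -
        (n : ℂ) • (1 : Matrix (Fin n × Fin n) (Fin n × Fin n) ℂ).submatrix id Prod.swap) = 0 := by
  rw [glTangentMap_eq_snd_aeval, algHom_pLambda, mapMatrix_aeval_mvPolynomialX,
    of_sum_scalarFamily_smul_X]
  set X' := (inlHom (MvPolynomial (Fin n × Fin n) ℂ) (MvPolynomial (Fin n × Fin n) ℂ)).mapMatrix
    (mvPolynomialX (Fin n) (Fin n) ℂ) with hX'
  set c' := algebraMap ℂ (DualNumber (MvPolynomial (Fin n × Fin n) ℂ)) (1 / 2) with hc'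
  have h2 : (inl (2 : MvPolynomial (Fin n × Fin n) ℂ) : DualNumber (MvPolynomial (Fin n × Fin n) ℂ))
      = 2 := map_ofNat (inlHom (MvPolynomial (Fin n × Fin n) ℂ) (MvPolynomial (Fin n × Fin n) ℂ)) 2
  have hN : (inl (n : MvPolynomial (Fin n × Fin n) ℂ) : DualNumber (MvPolynomial (Fin n × Fin n) ℂ))
      = n := map_natCast (inlHom (MvPolynomial (Fin n × Fin n) ℂ) (MvPolynomial (Fin n × Fin n) ℂ)) n
  have hV : (inlHom (MvPolynomial (Fin n × Fin n) ℂ) (MvPolynomial (Fin n × Fin n) ℂ)).mapMatrix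
      (((2 : MvPolynomial (Fin n × Fin n) ℂ) - n) • mvPolynomialX (Fin n) (Fin n) ℂ -
        (n : MvPolynomial (Fin n × Fin n) ℂ) • (mvPolynomialX (Fin n) (Fin n) ℂ)ᵀ) =
      ((2 : DualNumber (MvPolynomial (Fin n × Fin n) ℂ)) - n) • X' - (n : DualNumber (MvPolynomial (Fin n × Fin n) ℂ)) • X'ᵀ := by
    rw [map_sub, RingHom.mapMatrix_apply, RingHom.mapMatrix_apply,
      Matrix.map_smul' _ _ _ (map_mul _), Matrix.map_smul' _ _ _ (map_mul _), map_sub, map_natCast,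
      map_ofNat, hX', RingHom.mapMatrix_apply, Matrix.transpose_map]
  rw [hV]
  have hA : c' • ((X' + (ε : DualNumber (MvPolynomial (Fin n × Fin n) ℂ)) •
        (((2 : DualNumber (MvPolynomial (Fin n × Fin n) ℂ)) - n) • X' -
          (n : DualNumber (MvPolynomial (Fin n × Fin n) ℂ)) • X'ᵀ)) -
      (X' + (ε : DualNumber (MvPolynomial (Fin n × Fin n) ℂ)) •
        (((2 : DualNumber (MvPolynomial (Fin n × Fin n) ℂ)) - n) • X' -
          (n : DualNumber (MvPolynomial (Fin n × Fin n) ℂ)) • X'ᵀ))ᵀ) =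
      (1 + inl (2 : MvPolynomial (Fin n × Fin n) ℂ) * ε) • (c' • (X' - X'ᵀ)) := by
    rw [Matrix.transpose_add, Matrix.transpose_smul, Matrix.transpose_sub, Matrix.transpose_smul,
      Matrix.transpose_smul, Matrix.transpose_transpose, h2]
    module
  have hS : c' • ((X' + (ε : DualNumber (MvPolynomial (Fin n × Fin n) ℂ)) •
        (((2 : DualNumber (MvPolynomial (Fin n × Fin n) ℂ)) - n) • X' -
          (n : DualNumber (MvPolynomial (Fin n × Fin n) ℂ)) • X'ᵀ)) +
      (X' + (ε : DualNumber (MvPolynomial (Fin n × Fin n) ℂ)) •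
        (((2 : DualNumber (MvPolynomial (Fin n × Fin n) ℂ)) - n) • X' -
          (n : DualNumber (MvPolynomial (Fin n × Fin n) ℂ)) • X'ᵀ))ᵀ) =
      (1 + inl ((2 : MvPolynomial (Fin n × Fin n) ℂ) - 2 * n) * ε) • (c' • (X' + X'ᵀ)) := by
    have h22 : (inl ((2 : MvPolynomial (Fin n × Fin n) ℂ) - 2 * n) : DualNumber (MvPolynomial (Fin n × Fin n) ℂ)) = 2 - 2 * n := by
      have h := map_sub (inlHom (MvPolynomial (Fin n × Fin n) ℂ) (MvPolynomial (Fin n × Fin n) ℂ)) (2 : MvPolynomial (Fin n × Fin n) ℂ) (2 * (n : MvPolynomial (Fin n × Fin n) ℂ))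
      simp only [map_mul, map_ofNat, map_natCast] at h
      exact h
    rw [Matrix.transpose_add, Matrix.transpose_smul, Matrix.transpose_sub, Matrix.transpose_smul,
      Matrix.transpose_smul, Matrix.transpose_transpose, h22]
    module
  rw [hA, hS, Matrix.adjugate_smul, Fintype.card_fin, Matrix.smul_mul, Matrix.mul_smul, smul_smul,
    Matrix.trace_smul, smul_eq_mul]
  -- back to `inl (pLambda n)`-shaped pieces
  have hK := inl_pLambda n
  rw [← hX', ← hc'] at hK
  rw [← mul_assoc, mul_comm (algebraMap ℂ _ _), mul_assoc, ← hK, DualNumber.snd_mul, snd_inl,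
    mul_zero, zero_add, fst_inl, DualNumber.snd_mul, TrivSqZeroExt.snd_pow, TrivSqZeroExt.fst_pow]
  simp only [fst_add, snd_add, fst_one, snd_one, fst_mul, DualNumber.snd_mul, fst_inl, snd_inl,
    DualNumber.fst_eps, DualNumber.snd_eps, mul_zero, mul_one, zero_add, add_zero, one_pow,
    one_smul, nsmul_eq_mul, one_mul]
  rw [Nat.cast_sub hn]
  push_cast
  ring

/-- The linear vector field of the third family
`H(Z) = Zᵀ ⊗ 1 − (1 ⊗ Zᵀ)∘swap − 1 ⊗ Zᵀ + (Zᵀ ⊗ 1)∘swap ∈ 𝔤𝔩(M_n)` is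
`M ↦ Z(M − Mᵀ) − (M − Mᵀ)Zᵀ` (twice the symmetric part of `Z·(M − Mᵀ)`: an element of
`Hom(Λ², S²)`, arXiv `p0008.txt:L85–86`). [cite: LandsbergManivelRessayre2013, §3.5 (p. 481)] -/
theorem of_sum_homFamily_smul_X (Z : Matrix (Fin n) (Fin n) ℂ) :
    (Matrix.of fun i j : Fin n => ∑ a : Fin n × Fin n,
      (Zᵀ ⊗ₖ (1 : Matrix (Fin n) (Fin n) ℂ) -
        ((1 : Matrix (Fin n) (Fin n) ℂ) ⊗ₖ Zᵀ).submatrix id Prod.swap -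
        (1 : Matrix (Fin n) (Fin n) ℂ) ⊗ₖ Zᵀ +
        (Zᵀ ⊗ₖ (1 : Matrix (Fin n) (Fin n) ℂ)).submatrix id Prod.swap) a (i, j) •
          (MvPolynomial.X a : MvPolynomial (Fin n × Fin n) ℂ)) =
      Z.map (C : ℂ →+* MvPolynomial (Fin n × Fin n) ℂ) *
          (mvPolynomialX (Fin n) (Fin n) ℂ - (mvPolynomialX (Fin n) (Fin n) ℂ)ᵀ) -
        (mvPolynomialX (Fin n) (Fin n) ℂ - (mvPolynomialX (Fin n) (Fin n) ℂ)ᵀ) *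
          (Z.map (C : ℂ →+* MvPolynomial (Fin n × Fin n) ℂ))ᵀ := by
  have hZ : ∀ i j : Fin n, ∑ a : Fin n × Fin n, (Zᵀ ⊗ₖ (1 : Matrix (Fin n) (Fin n) ℂ)) a (i, j) •
      (MvPolynomial.X a : MvPolynomial (Fin n × Fin n) ℂ) =
        (Z.map (C : ℂ →+* MvPolynomial (Fin n × Fin n) ℂ) * mvPolynomialX (Fin n) (Fin n) ℂ) i j := by
    intro i j
    have h := sum_kronecker_smul_X Z 0 i j
    rwa [Matrix.kronecker_zero, add_zero, Matrix.map_zero _ (map_zero _), Matrix.mul_zero,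
      add_zero] at h
  have hZ' : ∀ i j : Fin n, ∑ a : Fin n × Fin n, ((1 : Matrix (Fin n) (Fin n) ℂ) ⊗ₖ Zᵀ) a (i, j) •
      (MvPolynomial.X a : MvPolynomial (Fin n × Fin n) ℂ) =
        (mvPolynomialX (Fin n) (Fin n) ℂ * (Z.map (C : ℂ →+* MvPolynomial (Fin n × Fin n) ℂ))ᵀ) i j := by
    intro i j
    have h := sum_kronecker_smul_X 0 Zᵀ i j
    rwa [Matrix.transpose_zero, Matrix.zero_kronecker, zero_add, Matrix.map_zero _ (map_zero _),
      Matrix.zero_mul, zero_add, Matrix.transpose_map] at h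
  refine Matrix.ext fun i j => ?_
  simp only [Matrix.of_apply, Matrix.add_apply, Matrix.sub_apply, add_smul, sub_smul,
    Finset.sum_add_distrib, Finset.sum_sub_distrib, Matrix.submatrix_apply, id, Prod.swap_prod_mk,
    hZ, hZ']
  have h1 : (mvPolynomialX (Fin n) (Fin n) ℂ * (Z.map (C : ℂ →+* MvPolynomial (Fin n × Fin n) ℂ))ᵀ) j i
      = (Z.map (C : ℂ →+* MvPolynomial (Fin n × Fin n) ℂ) * (mvPolynomialX (Fin n) (Fin n) ℂ)ᵀ) i j := by
    rw [← Matrix.transpose_apply (mvPolynomialX (Fin n) (Fin n) ℂ * _) i j, Matrix.transpose_mul,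
      Matrix.transpose_transpose]
  have h2 : (Z.map (C : ℂ →+* MvPolynomial (Fin n × Fin n) ℂ) * mvPolynomialX (Fin n) (Fin n) ℂ) j i
      = ((mvPolynomialX (Fin n) (Fin n) ℂ)ᵀ * (Z.map (C : ℂ →+* MvPolynomial (Fin n × Fin n) ℂ))ᵀ) i j := by
    rw [← Matrix.transpose_apply (Z.map _ * mvPolynomialX (Fin n) (Fin n) ℂ) i j, Matrix.transpose_mul]
  rw [h1, h2]
  simp only [Matrix.mul_sub, Matrix.sub_mul, Matrix.sub_apply]
  ring

/-- `tr(adj(A)·(Z(M−Mᵀ) − (M−Mᵀ)Zᵀ)) = 0` for the skew part `A = (M − Mᵀ)/2` of the generic matrix: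
`tr(adj(A) Z A) − tr(adj(A) A Zᵀ) = det(A)(tr Z − tr Zᵀ) = 0`.
[cite: LandsbergManivelRessayre2013, §3.5 (p. 481)] -/
theorem trace_adjugate_skewPartMatrix_mul_homField (Z : Matrix (Fin n) (Fin n) ℂ) :
    ((skewPartMatrix n).adjugate * (Z.map (C : ℂ →+* MvPolynomial (Fin n × Fin n) ℂ) *
          (mvPolynomialX (Fin n) (Fin n) ℂ - (mvPolynomialX (Fin n) (Fin n) ℂ)ᵀ) -
        (mvPolynomialX (Fin n) (Fin n) ℂ - (mvPolynomialX (Fin n) (Fin n) ℂ)ᵀ) *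
          (Z.map (C : ℂ →+* MvPolynomial (Fin n × Fin n) ℂ))ᵀ)).trace = 0 := by
  have hX : mvPolynomialX (Fin n) (Fin n) ℂ - (mvPolynomialX (Fin n) (Fin n) ℂ)ᵀ =
      (C (2 : ℂ) : MvPolynomial (Fin n × Fin n) ℂ) • skewPartMatrix n := by
    refine Matrix.ext fun i j => ?_
    simp only [skewPartMatrix, Matrix.sub_apply, Matrix.transpose_apply, mvPolynomialX_apply,
      Matrix.smul_apply, Matrix.of_apply, smul_eq_mul, ← mul_assoc, ← map_mul]
    norm_num
  rw [hX, Matrix.mul_smul, Matrix.smul_mul, ← smul_sub, Matrix.mul_smul, Matrix.trace_smul,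
    Matrix.mul_sub, Matrix.trace_sub, ← Matrix.mul_assoc, ← Matrix.mul_assoc, Matrix.trace_mul_cycle,
    Matrix.mul_adjugate, Matrix.adjugate_mul, Matrix.smul_mul, Matrix.smul_mul, Matrix.one_mul,
    Matrix.one_mul, Matrix.trace_smul, Matrix.trace_smul, Matrix.trace_transpose, sub_self, smul_zero]

/-- The field `Z(M−Mᵀ) − (M−Mᵀ)Zᵀ` is symmetric (it lies in `S² ⊂ M_n`).
[cite: LandsbergManivelRessayre2013, §3.5 (p. 481)] -/
theorem homField_transpose (Z : Matrix (Fin n) (Fin n) ℂ) :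
    (Z.map (C : ℂ →+* MvPolynomial (Fin n × Fin n) ℂ) *
          (mvPolynomialX (Fin n) (Fin n) ℂ - (mvPolynomialX (Fin n) (Fin n) ℂ)ᵀ) -
        (mvPolynomialX (Fin n) (Fin n) ℂ - (mvPolynomialX (Fin n) (Fin n) ℂ)ᵀ) *
          (Z.map (C : ℂ →+* MvPolynomial (Fin n × Fin n) ℂ))ᵀ)ᵀ =
      Z.map (C : ℂ →+* MvPolynomial (Fin n × Fin n) ℂ) *
          (mvPolynomialX (Fin n) (Fin n) ℂ - (mvPolynomialX (Fin n) (Fin n) ℂ)ᵀ) -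
        (mvPolynomialX (Fin n) (Fin n) ℂ - (mvPolynomialX (Fin n) (Fin n) ℂ)ᵀ) *
          (Z.map (C : ℂ →+* MvPolynomial (Fin n × Fin n) ℂ))ᵀ := by
  refine Matrix.ext fun i j => ?_
  simp only [Matrix.transpose_apply, Matrix.sub_apply, Matrix.mul_apply, ← Finset.sum_sub_distrib]
  exact Finset.sum_congr rfl fun k _ => by ring

/-- **The third family kills `P_Λ`**: `H(Z) · P_Λ = 0` for every `Z ∈ 𝔤𝔩_n`. Substituting
`M ↦ M + εV`, `V = Z(M−Mᵀ) − (M−Mᵀ)Zᵀ` symmetric, leaves the skew part `A` unchanged and moves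
`S ↦ S + εV`, and `tr(adj(A)V) = 0` (the `𝔰𝔩_n ⊂ Hom(Λ², S²)` part of the stabilizer,
arXiv `p0008.txt:L85–86`). [cite: LandsbergManivelRessayre2013, §3.5 (p. 481)] -/
theorem glTangentMap_pLambda_homFamily (Z : Matrix (Fin n) (Fin n) ℂ) :
    glTangentMap (pLambda n) (Zᵀ ⊗ₖ (1 : Matrix (Fin n) (Fin n) ℂ) -
        ((1 : Matrix (Fin n) (Fin n) ℂ) ⊗ₖ Zᵀ).submatrix id Prod.swap -
        (1 : Matrix (Fin n) (Fin n) ℂ) ⊗ₖ Zᵀ +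
        (Zᵀ ⊗ₖ (1 : Matrix (Fin n) (Fin n) ℂ)).submatrix id Prod.swap) = 0 := by
  rw [glTangentMap_eq_snd_aeval, algHom_pLambda, mapMatrix_aeval_mvPolynomialX,
    of_sum_homFamily_smul_X]
  set X' := (inlHom (MvPolynomial (Fin n × Fin n) ℂ) (MvPolynomial (Fin n × Fin n) ℂ)).mapMatrix
    (mvPolynomialX (Fin n) (Fin n) ℂ) with hX'
  set c' := algebraMap ℂ (DualNumber (MvPolynomial (Fin n × Fin n) ℂ)) (1 / 2) with hc'
  set V := Z.map (C : ℂ →+* MvPolynomial (Fin n × Fin n) ℂ) *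
          (mvPolynomialX (Fin n) (Fin n) ℂ - (mvPolynomialX (Fin n) (Fin n) ℂ)ᵀ) -
        (mvPolynomialX (Fin n) (Fin n) ℂ - (mvPolynomialX (Fin n) (Fin n) ℂ)ᵀ) *
          (Z.map (C : ℂ →+* MvPolynomial (Fin n × Fin n) ℂ))ᵀ with hV
  set V' := (inlHom (MvPolynomial (Fin n × Fin n) ℂ) (MvPolynomial (Fin n × Fin n) ℂ)).mapMatrix V
    with hV'
  have hVt : V'ᵀ = V' := by
    rw [hV', RingHom.mapMatrix_apply, ← Matrix.transpose_map, homField_transpose]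
  have hc2 : c' * 2 = 1 := by
    rw [hc', ← map_ofNat (algebraMap ℂ (DualNumber (MvPolynomial (Fin n × Fin n) ℂ))) 2, ← map_mul]
    norm_num
  have hA : c' • ((X' + (ε : DualNumber (MvPolynomial (Fin n × Fin n) ℂ)) • V') -
      (X' + (ε : DualNumber (MvPolynomial (Fin n × Fin n) ℂ)) • V')ᵀ) = c' • (X' - X'ᵀ) := by
    rw [Matrix.transpose_add, Matrix.transpose_smul, hVt]
    module
  have hS : c' • ((X' + (ε : DualNumber (MvPolynomial (Fin n × Fin n) ℂ)) • V') +
      (X' + (ε : DualNumber (MvPolynomial (Fin n × Fin n) ℂ)) • V')ᵀ) =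
      c' • (X' + X'ᵀ) + (ε : DualNumber (MvPolynomial (Fin n × Fin n) ℂ)) • V' := by
    rw [Matrix.transpose_add, Matrix.transpose_smul, hVt]
    match_scalars <;> first | ring1 | linear_combination (ε : DualNumber (MvPolynomial (Fin n × Fin n) ℂ)) * hc2
  rw [hA, hS, Matrix.mul_add, Matrix.trace_add, mul_add]
  have hK := inl_pLambda n
  rw [← hX', ← hc'] at hK
  -- the skew part `c' • (X' - X'ᵀ)` is `inl` of the typed skew part
  have hAX : c' • (X' - X'ᵀ) = (inlHom (MvPolynomial (Fin n × Fin n) ℂ) (MvPolynomial (Fin n × Fin n) ℂ)).mapMatrix (skewPartMatrix n) := by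
    rw [hc', hX']
    exact (inlHom_mapMatrix_skewPartMatrix n).symm
  rw [← hK, Matrix.mul_smul, Matrix.trace_smul, smul_eq_mul, snd_add, snd_inl, zero_add, hAX, hV',
    hV, ← RingHom.map_adjugate, ← map_mul (inlHom (MvPolynomial (Fin n × Fin n) ℂ) (MvPolynomial (Fin n × Fin n) ℂ)).mapMatrix, RingHom.mapMatrix_apply,
    ← AddMonoidHom.map_trace (inlHom (MvPolynomial (Fin n × Fin n) ℂ) (MvPolynomial (Fin n × Fin n) ℂ)), trace_adjugate_skewPartMatrix_mul_homField, map_zero,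
    mul_zero, mul_zero, snd_zero]

/-! ### The count: `2n² − 1 ≤ dim 𝔤𝔩(W)_{P_Λ}` -/

section Count

/-- In `Fin n`, `n ≥ 3`, there is an index different from two given ones. [folklore] -/
private theorem exists_ne_ne_fin {n : ℕ} (h3 : 3 ≤ n) (j k : Fin n) : ∃ i : Fin n, i ≠ j ∧ i ≠ k := by
  have hc : ({j, k} : Finset (Fin n)).card < (Finset.univ : Finset (Fin n)).card := by
    rw [Finset.card_univ, Fintype.card_fin]
    exact lt_of_le_of_lt Finset.card_le_two (by omega)
  obtain ⟨i, -, hi⟩ := Finset.exists_mem_notMem_of_card_lt_card hc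
  simp only [Finset.mem_insert, Finset.mem_singleton, not_or] at hi
  exact ⟨i, hi.1, hi.2⟩

/-- **The kernel of the parametrisation** `(Z₁, c, Z₂) ↦ L₁(Z₁) + c·L₂ + H(Z₂)` of the three
families is the line `ℂ·(0, 0, 1)` (`H(1) = 0`): the independence count behind
"isomorphic with `𝔤𝔩_n ⊕ 𝔤𝔩_n` … dimension `2n²`" (arXiv `p0009.txt:L1–2`), for `n ≥ 3`.
[cite: LandsbergManivelRessayre2013, §3.5 (p. 481)] -/
theorem pLambdaFamily_kernel (h3 : 3 ≤ n) (Z₁ Z₂ : Matrix (Fin n) (Fin n) ℂ) (c : ℂ)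
    (h : Z₁ᵀ ⊗ₖ (1 : Matrix (Fin n) (Fin n) ℂ) + (1 : Matrix (Fin n) (Fin n) ℂ) ⊗ₖ Z₁ᵀ +
      c • (((2 : ℂ) - n) • (1 : Matrix (Fin n × Fin n) (Fin n × Fin n) ℂ) -
        (n : ℂ) • (1 : Matrix (Fin n × Fin n) (Fin n × Fin n) ℂ).submatrix id Prod.swap) +
      (Z₂ᵀ ⊗ₖ (1 : Matrix (Fin n) (Fin n) ℂ) -
        ((1 : Matrix (Fin n) (Fin n) ℂ) ⊗ₖ Z₂ᵀ).submatrix id Prod.swap -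
        (1 : Matrix (Fin n) (Fin n) ℂ) ⊗ₖ Z₂ᵀ +
        (Z₂ᵀ ⊗ₖ (1 : Matrix (Fin n) (Fin n) ℂ)).submatrix id Prod.swap) = 0) :
    Z₁ = 0 ∧ c = 0 ∧ ∃ β : ℂ, Z₂ = β • (1 : Matrix (Fin n) (Fin n) ℂ) := by
  have e : ∀ k l i j : Fin n,
      (Z₁ᵀ ⊗ₖ (1 : Matrix (Fin n) (Fin n) ℂ) + (1 : Matrix (Fin n) (Fin n) ℂ) ⊗ₖ Z₁ᵀ +
      c • (((2 : ℂ) - n) • (1 : Matrix (Fin n × Fin n) (Fin n × Fin n) ℂ) -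
        (n : ℂ) • (1 : Matrix (Fin n × Fin n) (Fin n × Fin n) ℂ).submatrix id Prod.swap) +
      (Z₂ᵀ ⊗ₖ (1 : Matrix (Fin n) (Fin n) ℂ) -
        ((1 : Matrix (Fin n) (Fin n) ℂ) ⊗ₖ Z₂ᵀ).submatrix id Prod.swap -
        (1 : Matrix (Fin n) (Fin n) ℂ) ⊗ₖ Z₂ᵀ +
        (Z₂ᵀ ⊗ₖ (1 : Matrix (Fin n) (Fin n) ℂ)).submatrix id Prod.swap)) (k, l) (i, j) = 0 :=
    fun k l i j => by rw [h]; rfl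
  -- Step 1: `Z₂` is diagonal.
  have h2off : ∀ j k : Fin n, j ≠ k → Z₂ j k = 0 := by
    intro j k hjk
    obtain ⟨i, hij, hik⟩ := exists_ne_ne_fin h3 j k
    have := e k i i j
    simpa [Matrix.add_apply, Matrix.sub_apply, Matrix.smul_apply, Matrix.kroneckerMap_apply,
      Matrix.one_apply, Matrix.submatrix_apply, hij, hik, hjk, hij.symm, hik.symm, hjk.symm]
      using this
  -- Step 2: `Z₁` is diagonal.
  have h1off : ∀ i k : Fin n, i ≠ k → Z₁ i k = 0 := by
    intro i k hik
    obtain ⟨j, hji, hjk⟩ := exists_ne_ne_fin h3 i k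
    have := e k j i j
    simpa [Matrix.add_apply, Matrix.sub_apply, Matrix.smul_apply, Matrix.kroneckerMap_apply,
      Matrix.one_apply, Matrix.submatrix_apply, hik, hji, hjk, hik.symm, hji.symm, hjk.symm,
      h2off i k hik] using this
  -- Step 3: `c = 0` and the diagonal of `Z₂` is constant.
  have h3' : ∀ i j : Fin n, i ≠ j → -(c * n) - Z₂ i i + Z₂ j j = 0 := by
    intro i j hij
    have := e j i i j
    simp only [Matrix.add_apply, Matrix.sub_apply, Matrix.smul_apply, Matrix.kroneckerMap_apply,
      Matrix.one_apply, Matrix.submatrix_apply, Matrix.transpose_apply, id, Prod.swap_prod_mk,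
      Prod.mk.injEq, hij, hij.symm, if_false, if_true, and_self, mul_one,
      mul_zero, zero_mul, one_mul, smul_eq_mul, sub_zero, zero_add, add_zero, zero_sub] at this
    linear_combination this
  have hn0 : (n : ℂ) ≠ 0 := by exact_mod_cast (show n ≠ 0 by omega)
  obtain ⟨a, b, hab⟩ : ∃ a b : Fin n, a ≠ b :=
    ⟨⟨0, by omega⟩, ⟨1, by omega⟩, by simp [Fin.ext_iff]⟩
  have hc : c = 0 := by
    have h1 := h3' a b hab
    have h2 := h3' b a hab.symm
    have : c * n = 0 := by linear_combination (-(h1 + h2)) / 2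
    exact (mul_eq_zero.1 this).resolve_right hn0
  have h2diag : ∀ i j : Fin n, Z₂ i i = Z₂ j j := by
    intro i j
    by_cases hij : i = j
    · rw [hij]
    · have := h3' i j hij
      rw [hc, zero_mul, neg_zero, zero_sub] at this
      linear_combination -this
  -- Step 4: the diagonal of `Z₁` vanishes.
  have h4 : ∀ i j : Fin n, i ≠ j → Z₁ i i + Z₁ j j = 0 := by
    intro i j hij
    have := e i j i j
    simp only [Matrix.add_apply, Matrix.sub_apply, Matrix.smul_apply, Matrix.kroneckerMap_apply,
      Matrix.one_apply, Matrix.submatrix_apply, Matrix.transpose_apply, id, Prod.swap_prod_mk,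
      Prod.mk.injEq, hij, hij.symm, if_false, if_true, and_self, mul_one,
      mul_zero, zero_mul, one_mul, smul_eq_mul, sub_zero, add_zero, hc, h2diag i j] at this
    linear_combination this
  have h1diag : ∀ i : Fin n, Z₁ i i = 0 := by
    intro i
    obtain ⟨j, hji, -⟩ := exists_ne_ne_fin h3 i i
    obtain ⟨k, hki, hkj⟩ := exists_ne_ne_fin h3 i j
    have e1 := h4 i j hji.symm
    have e2 := h4 i k hki.symm
    have e3 := h4 j k hkj.symm
    linear_combination (e1 + e2 - e3) / 2
  refine ⟨?_, hc, ⟨Z₂ a a, ?_⟩⟩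
  · ext i k
    by_cases hik : i = k
    · subst hik; rw [h1diag, Matrix.zero_apply]
    · rw [h1off i k hik, Matrix.zero_apply]
  · ext i k
    by_cases hik : i = k
    · subst hik; rw [Matrix.smul_apply, Matrix.one_apply_eq, smul_eq_mul, mul_one, h2diag i a]
    · rw [h2off i k hik, Matrix.smul_apply, Matrix.one_apply_ne hik, smul_zero]

/-- **Lower bound on the annihilator of `P_Λ`**: `2n² − 1 ≤ dim 𝔤𝔩(W)_{P_Λ}` (`n ≥ 3`),
witnessed by the `(2n²+1)`-parameter family `L₁(Z₁) + c·L₂ + H(Z₂)` (`tr Z₁ = 0`; kernel a line):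
the explicit half of "the contribution of the remaining terms is isomorphic with `𝔤𝔩_n ⊕ 𝔤𝔩_n`. In
particular it has dimension `2n²`" (projectively; `2n² − 1` for the annihilator of `P_Λ` itself;
arXiv `p0009.txt:L1–2`). The reverse inequality (exclusion of `EA, ES, EAS, ESA`) is not proved
here. [cite: LandsbergManivelRessayre2013, §3.5 (p. 481)] -/
theorem finrank_glAnn_pLambda_ge (h3 : 3 ≤ n) :
    2 * n ^ 2 - 1 ≤ Module.finrank ℂ (glAnn (pLambda n)) := by
  let Φ : (Matrix (Fin n) (Fin n) ℂ × (ℂ × Matrix (Fin n) (Fin n) ℂ)) →ₗ[ℂ]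
      Matrix (Fin n × Fin n) (Fin n × Fin n) ℂ :=
    { toFun := fun v =>
        v.1ᵀ ⊗ₖ (1 : Matrix (Fin n) (Fin n) ℂ) + (1 : Matrix (Fin n) (Fin n) ℂ) ⊗ₖ v.1ᵀ +
        v.2.1 • (((2 : ℂ) - n) • (1 : Matrix (Fin n × Fin n) (Fin n × Fin n) ℂ) -
          (n : ℂ) • (1 : Matrix (Fin n × Fin n) (Fin n × Fin n) ℂ).submatrix id Prod.swap) +
        (v.2.2ᵀ ⊗ₖ (1 : Matrix (Fin n) (Fin n) ℂ) -
          ((1 : Matrix (Fin n) (Fin n) ℂ) ⊗ₖ v.2.2ᵀ).submatrix id Prod.swap -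
          (1 : Matrix (Fin n) (Fin n) ℂ) ⊗ₖ v.2.2ᵀ +
          (v.2.2ᵀ ⊗ₖ (1 : Matrix (Fin n) (Fin n) ℂ)).submatrix id Prod.swap)
      map_add' := fun v w => by
        simp only [Prod.fst_add, Prod.snd_add, Matrix.transpose_add, Matrix.add_kronecker,
          Matrix.kronecker_add, Matrix.submatrix_add, Pi.add_apply]
        module
      map_smul' := fun r v => by
        simp only [Prod.smul_fst, Prod.smul_snd, Matrix.transpose_smul, Matrix.smul_kronecker,
          Matrix.kronecker_smul, Matrix.submatrix_smul, Pi.smul_apply, RingHom.id_apply]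
        module }
  let τ : (Matrix (Fin n) (Fin n) ℂ × (ℂ × Matrix (Fin n) (Fin n) ℂ)) →ₗ[ℂ] ℂ :=
    Matrix.traceLinearMap (Fin n) ℂ ℂ ∘ₗ LinearMap.fst ℂ _ _
  have h := finrank_le_finrank_add_two Φ τ (glAnn (pLambda n))
    ((0 : Matrix (Fin n) (Fin n) ℂ), ((0 : ℂ), (1 : Matrix (Fin n) (Fin n) ℂ))) ?_ ?_
  · rw [Module.finrank_prod, Module.finrank_prod, Module.finrank_matrix, Module.finrank_self,
      Fintype.card_fin, mul_one] at h
    have : n ^ 2 = n * n := sq n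
    omega
  · rintro ⟨Z₁, c, Z₂⟩ hv
    obtain ⟨hZ₁, hc, β, hZ₂⟩ := pLambdaFamily_kernel n h3 Z₁ Z₂ c hv
    refine ⟨β, ?_⟩
    ext1
    · simp [hZ₁]
    · ext1
      · simp [hc]
      · simp [hZ₂]
  · rintro ⟨Z₁, c, Z₂⟩ hv
    have hv' : Z₁.trace = 0 := hv
    rw [mem_glAnn_iff_glTangentMap_eq_zero]
    change glTangentMap (pLambda n) (Z₁ᵀ ⊗ₖ (1 : Matrix (Fin n) (Fin n) ℂ) +
        (1 : Matrix (Fin n) (Fin n) ℂ) ⊗ₖ Z₁ᵀ +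
      c • (((2 : ℂ) - n) • (1 : Matrix (Fin n × Fin n) (Fin n × Fin n) ℂ) -
        (n : ℂ) • (1 : Matrix (Fin n × Fin n) (Fin n × Fin n) ℂ).submatrix id Prod.swap) +
      (Z₂ᵀ ⊗ₖ (1 : Matrix (Fin n) (Fin n) ℂ) -
        ((1 : Matrix (Fin n) (Fin n) ℂ) ⊗ₖ Z₂ᵀ).submatrix id Prod.swap -
        (1 : Matrix (Fin n) (Fin n) ℂ) ⊗ₖ Z₂ᵀ +
        (Z₂ᵀ ⊗ₖ (1 : Matrix (Fin n) (Fin n) ℂ)).submatrix id Prod.swap)) = 0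
    rw [map_add, map_add, map_smul, glTangentMap_pLambda_kronecker,
      glTangentMap_pLambda_scalarFamily n (by omega), glTangentMap_pLambda_homFamily, hv',
      mul_zero, zero_smul, smul_zero, add_zero, add_zero]

/-- The rank–nullity corollary: `dim 𝔤𝔩(W)·P_Λ ≤ n⁴ − 2n² + 1`.
[cite: LandsbergManivelRessayre2013, §3.5 (p. 481)] -/
theorem finrank_glTangent_pLambda_add_le (h3 : 3 ≤ n) :
    Module.finrank ℂ (glTangent (pLambda n)) + (2 * n ^ 2 - 1) ≤ n ^ 4 := by
  have h1 := finrank_glTangent_add_finrank_glAnn (pLambda n)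
  have h2 := finrank_glAnn_pLambda_ge n h3
  rw [Fintype.card_prod, Fintype.card_fin] at h1
  have h4 : (n * n) ^ 2 = n ^ 4 := by ring
  omega

end Count

end PLambda

end StabilizerDimensions

end Literature.Computability.AlgebraicComplexity

end
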